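import Summits.ValiantsHypothesis.ValiantsHypothesis.Theorems.NewtonUnitEquationsTwoProductsSubmergedWitness
import Summits.ValiantsHypothesis.ValiantsHypothesis.Theorems.NewtonUnitEquationsTwoProductsPlanarCrossQuasiPoly

/-!
# K4 `submerged-band-filtration` — THE REDUCTION `SubmergedReduction` (val-idea-36 g0's L2): `SubmergedCellLaw a b → CellLaw (a+1) (b+1)`

`submergedReduction_holds : SubmergedReduction` (texts in `…SubmergedDefs`).  Proof (band filtration): fix a cell family `S` of the
instance `(u, v)` with letter order `R` on the tail support `T` (`#T ≤ 2mt`).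
* If `R` ties two DISTINCT letters, all witnesses are positively proportional and `#S ≤ 1` (`card_le_one_of_letter_tie`).
* Otherwise `R` is strict on `T`; at most ONE point of `S` is itself a letter (`PlanarCell.eq_of_visible_mem_tailSupport`), and every other
  point `l` has a TIE-FREE witness `ξ_l` (`exists_tieFree_witness`).  Assign to `l` the band `D(l) = {e ∈ T : wt ξ_l e < wt ξ_l l}`; the
  bands form a CHAIN of subsets of `T` (they are lower sets of the common total preorder `R`), so at most `#T + 1` of them occur; and the
  points with a given band `D₀` form a SUBMERGED cell family (same `R`) of the truncation `(dropSet u D₀, dropSet v D₀)` — the strict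
  log-top transfers because the deleted letters lie strictly below it (`isStrictTop_logSupport_dropSet_of_lt`), the remaining letters lie
  strictly above it by tie-freeness, and normalisation / sparsity / validity are inherited.  Hence
  `#S ≤ 1 + (#T + 1)·2^{am}(t+2)^b ≤ (2mt + 2)·2^{am}(t+2)^b ≤ 2^{(a+1)m}(t+2)^{b+1}`.
HONEST LABEL (merged-desk RULING #333 (b)): K4 is an exact REDUCTION of the per-cell law to submerged cells (conversely `CellLaw a b →
SubmergedCellLaw a b` trivially), i.e. infrastructure «WLOG submerged»; it does NOT shrink the law: the residual label of record stays
«`ResidualLawV23` = `PlanarCellBound` as a law» (`Negative/RaySplitResidual.residualV23_iff_planarCellBound`, p662518).  Nothing here closes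
5906 (`TwoProducts` / `ResidualLawV23` / `PlanarCellBound` OPEN); VP ≠ VNP is NOT proved.  Helper mode (`--supports stmt-ValiantsHypothesis-5906
--as helper`).  No instances, no notation, no named facts. [folklore]
-/

noncomputable section
set_option linter.dupNamespace false

namespace Summit.ValiantsHypothesis.ValiantsHypothesis.Theorems.NewtonUnitEquations.TwoProducts.Submerged
open scoped BigOperators
open MvPolynomial
open Summit.ValiantsHypothesis.ValiantsHypothesis.Theorems.NewtonUnitEquations.TwoProducts.FormalLogLinearisation
open Summit.ValiantsHypothesis.ValiantsHypothesis.Theorems.NewtonUnitEquations.TwoProducts.PlanarCell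

variable {m : ℕ}

/-! ## Counting tools -/

/-- The tail support of a `t`-sparse instance has at most `2mt` letters. [folklore] -/
theorem card_tailSupport_le (u v : Fin m → MvPolynomial (Fin 2) ℂ) (t : ℕ) (hu : ∀ j, (u j).support.card ≤ t)
    (hv : ∀ j, (v j).support.card ≤ t) : (tailSupport u v).card ≤ 2 * m * t := by
  classical
  unfold tailSupport
  have h1 : (Finset.univ.biUnion fun j => (u j).support).card ≤ m * t :=
    calc (Finset.univ.biUnion fun j => (u j).support).card ≤ ∑ j, (u j).support.card := Finset.card_biUnion_le
      _ ≤ ∑ _j : Fin m, t := Finset.sum_le_sum fun j _ => hu j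
      _ = m * t := by simp
  have h2 : (Finset.univ.biUnion fun j => (v j).support).card ≤ m * t :=
    calc (Finset.univ.biUnion fun j => (v j).support).card ≤ ∑ j, (v j).support.card := Finset.card_biUnion_le
      _ ≤ ∑ _j : Fin m, t := Finset.sum_le_sum fun j _ => hv j
      _ = m * t := by simp
  calc _ ≤ (Finset.univ.biUnion fun j => (u j).support).card + (Finset.univ.biUnion fun j => (v j).support).card :=
        Finset.card_union_le _ _
    _ ≤ m * t + m * t := add_le_add h1 h2
    _ = 2 * m * t := by ring

/-- The band budget: `(2mt + 2) · 2^{am} (t+2)^b ≤ 2^{(a+1)m} (t+2)^{b+1}`. [folklore] -/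
theorem band_arith (a b m t n : ℕ) (hn : n ≤ 2 * m * t) :
    (n + 2) * (2 ^ (a * m) * (t + 2) ^ b) ≤ 2 ^ ((a + 1) * m) * (t + 2) ^ (b + 1) := by
  have h1 : n + 2 ≤ 2 ^ m * (t + 2) := by
    -- `2m ≤ 2^m` (also landed as `Literature.NumberTheory.EllipticCurves.two_mul_le_two_pow`; re-derived inline from `m < 2^m`)
    have h2 : 2 * m ≤ 2 ^ m := by
      rcases Nat.eq_zero_or_pos m with hm | hm
      · simp [hm]
      · have h4 : m - 1 < 2 ^ (m - 1) := Nat.lt_two_pow_self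
        have h5 : 2 ^ m = 2 * 2 ^ (m - 1) := by
          rw [← Nat.pow_succ']
          congr 1
          omega
        omega
    have h3 : 1 ≤ 2 ^ m := Nat.one_le_two_pow
    calc n + 2 ≤ 2 * m * t + 2 := by omega
      _ ≤ 2 ^ m * t + 2 ^ m * 2 := by nlinarith
      _ = 2 ^ m * (t + 2) := by ring
  calc (n + 2) * (2 ^ (a * m) * (t + 2) ^ b) ≤ (2 ^ m * (t + 2)) * (2 ^ (a * m) * (t + 2) ^ b) :=
        Nat.mul_le_mul_right _ h1
    _ = 2 ^ ((a + 1) * m) * (t + 2) ^ (b + 1) := by ring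

/-- A chain of subsets of `T` has at most `#T + 1` members. [folklore] -/
theorem card_chain_le {α : Type*} [DecidableEq α] (T : Finset α) (𝒞 : Finset (Finset α)) (hsub : ∀ D ∈ 𝒞, D ⊆ T)
    (hchain : ∀ D₁ ∈ 𝒞, ∀ D₂ ∈ 𝒞, D₁ ⊆ D₂ ∨ D₂ ⊆ D₁) : 𝒞.card ≤ T.card + 1 := by
  calc 𝒞.card ≤ (Finset.range (T.card + 1)).card := by
        refine Finset.card_le_card_of_injOn (fun D => D.card) (fun D hD => ?_) (fun D₁ hD₁ D₂ hD₂ hcard => ?_)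
        · exact Finset.mem_coe.2 (Finset.mem_range.2 (Nat.lt_succ_of_le (Finset.card_le_card (hsub D hD))))
        · simp only at hcard
          rcases hchain D₁ hD₁ D₂ hD₂ with h | h
          · exact Finset.eq_of_subset_of_card_le h hcard.ge
          · exact (Finset.eq_of_subset_of_card_le h hcard.le).symm
    _ = T.card + 1 := Finset.card_range _

/-! ## The reduction -/

/-- **K4 L2 — THE SUBMERGED REDUCTION** (`SubmergedReduction`, val-idea-36 g0's text verbatim in `…SubmergedDefs`): the per-cell law
for SUBMERGED cell families with exponents `(a, b)` implies the per-cell law for ALL cell families with exponents `(a+1, b+1)`.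
HONEST LABEL: an exact reduction (infrastructure «WLOG submerged»), not a shrinking of the law — the residual label of record is
unchanged («= `PlanarCellBound` as a law»); 5906 OPEN; VP ≠ VNP NOT proved. [folklore] -/
theorem submergedReduction_holds : SubmergedReduction := by
  intro a b hSub m t ht u v hu hv R S hS
  classical
  set T := tailSupport u v with hT
  have hu0 : ∀ j, coeff 0 (u j) = 0 := fun j => (hu j).1
  have hv0 : ∀ j, coeff 0 (v j) = 0 := fun j => (hv j).1
  set X : ℕ := 2 ^ (a * m) * (t + 2) ^ b with hX
  have hX1 : 1 ≤ X := Nat.one_le_iff_ne_zero.2 (Nat.mul_ne_zero (pow_ne_zero _ (by norm_num)) (pow_ne_zero _ (by omega)))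
  have hTcard : T.card ≤ 2 * m * t := card_tailSupport_le u v t (fun j => (hu j).2) (fun j => (hv j).2)
  suffices hmain : S.card ≤ (T.card + 2) * X from hmain.trans (band_arith a b m t T.card hTcard)
  -- Case A: the cell order ties two distinct letters
  by_cases htie : ∃ e₁ ∈ T, ∃ e₂ ∈ T, e₁ ≠ e₂ ∧ R e₁ e₂ ∧ R e₂ e₁
  · obtain ⟨e₁, he₁, e₂, he₂, hne, h12, h21⟩ := htie
    have h1 := card_le_one_of_letter_tie u v R S hS he₁ he₂ hne h12 h21
    calc S.card ≤ 1 := h1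
      _ ≤ 1 * X := by simpa using hX1
      _ ≤ (T.card + 2) * X := Nat.mul_le_mul_right _ (by omega)
  -- Case B: the cell order is strict on the letters
  push Not at htie
  -- at most one visible letter
  have hST : (S ∩ T).card ≤ 1 := by
    refine Finset.card_le_one.2 fun l hl l' hl' => ?_
    obtain ⟨hlS, hlT⟩ := Finset.mem_inter.1 hl
    obtain ⟨hl'S, hl'T⟩ := Finset.mem_inter.1 hl'
    obtain ⟨ξ, -, htop, hR⟩ := hS l hlS
    obtain ⟨ξ', -, htop', hR'⟩ := hS l' hl'S
    exact eq_of_visible_mem_tailSupport u v R hlT hl'T htop htop' hR hR'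
  set S' := S \ T with hS'
  -- tie-free witnesses for the non-letter points
  have hwit : ∀ l ∈ S', ∃ ξ' : Fin 2 → ℝ, ValidWeight u v ξ' ∧ IsStrictTop ξ' (logSupport u v) l ∧
      (∀ e ∈ T, ∀ e' ∈ T, (R e e' ↔ wt ξ' e ≤ wt ξ' e')) ∧ ∀ e ∈ T, wt ξ' e ≠ wt ξ' l := by
    intro l hl
    obtain ⟨hlS, hlT⟩ := Finset.mem_sdiff.1 hl
    obtain ⟨ξ, hξ, htop, hR⟩ := hS l hlS
    have hinj : ∀ e ∈ T, ∀ e' ∈ T, wt ξ e = wt ξ e' → e = e' := by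
      intro e he e' he' heq
      by_contra hne
      exact htie e he e' he' hne ((hR e he e' he').2 heq.le) ((hR e' he' e he).2 heq.ge)
    obtain ⟨ξ', hξ', htop', hord, hfree⟩ := exists_tieFree_witness u v hu0 hv0 ξ hξ l htop hinj
    refine ⟨ξ', hξ', htop', fun e he e' he' => (hR e he e' he').trans (hord e he e' he'), fun e he => hfree e he ?_⟩
    rintro rfl
    exact hlT he
  choose! ξw hξw using hwit
  -- the band of a point: the letters strictly below it at its tie-free witness
  let D : Expo → Finset Expo := fun l => T.filter (fun e => wt (ξw l) e < wt (ξw l) l)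
  have hDsub : ∀ l, D l ⊆ T := fun l => Finset.filter_subset _ _
  -- (i) each fibre of the band map is a submerged cell family of the corresponding truncation
  have hfib : ∀ D₀ ∈ S'.image D, (S'.filter (fun l => D l = D₀)).card ≤ X := by
    intro D₀ _
    refine hSub m t ht (dropSet u D₀) (dropSet v D₀) (norm_dropSet D₀ hu) (norm_dropSet D₀ hv) R _ fun l hl => ?_
    obtain ⟨hlS', hDl⟩ := Finset.mem_filter.1 hl
    obtain ⟨hval, htop, hR', hfree⟩ := hξw l hlS'
    refine ⟨ξw l, validWeight_dropSet hval D₀, ?_, ?_, ?_⟩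
    · refine isStrictTop_logSupport_dropSet_of_lt u v hu0 hv0 (ξw l) hval D₀ l (fun e he => ?_) htop
      rw [← hDl] at he
      exact (Finset.mem_filter.1 he).2
    · intro e he e' he'
      exact hR' e (tailSupport_dropSet_subset u v D₀ he) e' (tailSupport_dropSet_subset u v D₀ he')
    · intro e he
      rw [tailSupport_dropSet] at he
      obtain ⟨heT, heD⟩ := Finset.mem_sdiff.1 he
      have hnlt : ¬ wt (ξw l) e < wt (ξw l) l := fun hlt' => heD (hDl ▸ Finset.mem_filter.2 ⟨heT, hlt'⟩)
      exact lt_of_le_of_ne (not_lt.1 hnlt) (Ne.symm (hfree e heT))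
  -- (ii) the bands form a chain
  have hchain : ∀ D₁ ∈ S'.image D, ∀ D₂ ∈ S'.image D, D₁ ⊆ D₂ ∨ D₂ ⊆ D₁ := by
    intro D₁ hD₁ D₂ hD₂
    obtain ⟨l₁, h₁, rfl⟩ := Finset.mem_image.1 hD₁
    obtain ⟨l₂, h₂, rfl⟩ := Finset.mem_image.1 hD₂
    by_contra hcon
    push Not at hcon
    obtain ⟨h12, h21⟩ := hcon
    obtain ⟨e, he1, he2⟩ := Finset.not_subset.1 h12
    obtain ⟨e', he'2, he'1⟩ := Finset.not_subset.1 h21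
    have heT : e ∈ T := (Finset.mem_filter.1 he1).1
    have he'T : e' ∈ T := (Finset.mem_filter.1 he'2).1
    obtain ⟨-, -, hR1, -⟩ := hξw l₁ h₁
    obtain ⟨-, -, hR2, -⟩ := hξw l₂ h₂
    rcases le_total (wt (ξw l₁) e) (wt (ξw l₁) e') with hle | hle
    · have h2 : wt (ξw l₂) e ≤ wt (ξw l₂) e' := (hR2 e heT e' he'T).1 ((hR1 e heT e' he'T).2 hle)
      have h3 : wt (ξw l₂) e' < wt (ξw l₂) l₂ := (Finset.mem_filter.1 he'2).2
      exact he2 (Finset.mem_filter.2 ⟨heT, lt_of_le_of_lt h2 h3⟩)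
    · have h3 : wt (ξw l₁) e < wt (ξw l₁) l₁ := (Finset.mem_filter.1 he1).2
      exact he'1 (Finset.mem_filter.2 ⟨he'T, lt_of_le_of_lt hle h3⟩)
  have himg : (S'.image D).card ≤ T.card + 1 :=
    card_chain_le T (S'.image D) (fun D₀ hD₀ => by
      obtain ⟨l, -, rfl⟩ := Finset.mem_image.1 hD₀
      exact hDsub l) hchain
  -- (iii) count
  have hS'card : S'.card ≤ X * (S'.image D).card := Finset.card_le_mul_card_image S' X hfib
  have hsplit : S.card = (S ∩ T).card + S'.card := (Finset.card_inter_add_card_sdiff S T).symm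
  calc S.card = (S ∩ T).card + S'.card := hsplit
    _ ≤ 1 + X * (T.card + 1) := add_le_add hST (hS'card.trans (Nat.mul_le_mul_left _ himg))
    _ ≤ X + X * (T.card + 1) := by omega
    _ = (T.card + 2) * X := by ring

end Summit.ValiantsHypothesis.ValiantsHypothesis.Theorems.NewtonUnitEquations.TwoProducts.Submerged

end
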